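import Summits.QuantumFields.BalabanUV.Beta.FP.TorusCompositeInsertionKernelPackedSym
import Summits.QuantumFields.BalabanUV.Beta.FP.CompositeKernelFunctionalStep
import Summits.QuantumFields.BalabanUV.Beta.CompositeVertexKernelRec
import Summits.QuantumFields.BalabanUV.Beta.FP.TorusCompositeVertexJunction

/-!
# `BalabanUV.Beta.FP.TorusCompositeVertexJunctionSym` — road «FP» for binder row D1, ROUTE T, (β1) «sym» column: **F4-Sym — THE ORDER-1 (C1) Q-JUNCTION FOR THE
# CENTRED SYM BRICKS, END TO END: OUR sym composite first-order insertion jet `compIns₁Sym Lc M lev rs n h` IS, ENTRYWISE on the (multiplier, field) slots, the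
# `h`-weighted torus insertion of the row's PACKED COMPOSITE VERTEX FAMILY `u_n • compVhS ℓˢ 𝓋ˢ Lc n` over an1's CENTRED SYM bricks
# `ℓˢ m := symLinKerAt (ctr (d+1) Lc) Lc`, `𝓋ˢ m := symVhKerAt (ctr (d+1) Lc) Lc` (constant in the storey `m`), unit `u_n = (∏_{i<n} stepScale d Lc (lev (i+1))) · #box^n`**
# — no hypothesis beyond `hc : ctrOff (d+1) Lc ∈ box (d+1) Lc` (the (β1) twin of `TorusCompositeVertexJunction`; Q-leaf02-g32-1's default (ii) REALISED:
# the sym column's carriers are an2's brick-parametric recursions `compLinKer ∕ compVHKer` (`CompositeVertexKernelRec`) fed the sym bricks)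

WHAT.  §1 plumbing (scalars into pairings; the window as a bond `Finset`; copies of the rooted file's four lemmas).  §2 **`symKernelFunctionals_spec`** — a PAIR of
functionals `(𝓡, 𝓘)` satisfying the four clauses of `TorusCompositeInsertionPeriodicSym` (`hR0 ∕ hRsucc` — the sym one-step rows law; `h0 ∕ hsucc` — OUR sym chain
rule) whose values are, at every depth `n` and every `lev`, the KERNEL FUNCTIONALS of an2's composite kernels over the sym bricks with unit `u_n`:
`𝓡 lev n B l z = u_n · Σ'_w Σ_m compLinKer ℓˢ Lc n (m,w) (l,z) · B m w`, `𝓘 lev n H B κ x = u_n · Σ'_u Σ_{κ′} (Σ'_z Σ_l compVHKer ℓˢ 𝓋ˢ Lc n κ x (l,z) (κ′,u) · B l z) · H κ′ u`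
(rows: an2's top peel `compLinKer_succ` + the window; jet: R-13 `pairing_of_kernel_succ` at an2's top peel `compVHKer_succ`, read backwards; units `u_{n+1} = θ_n · u′_n ² =
stepScale d Lc (lev 1) · #box · u′_n`).  §3 **`sum_mul_perZ_dper_compVhS_eq_compIns₁Sym_apply`**:
`Σ_b h b · perZ T (dper T (u_n • compVhS ℓˢ 𝓋ˢ Lc n b.2 b.1)) (Lc^n • x̄) z (inr κ) (inl β) = compIns₁Sym Lc M lev rs n h (x̄, κ) (z, β)` (`T = towerTorus Lc M n`), and the
one-bond form = the `-Sym` door's `hQF₁ ∕ hQF₁′` at the row's sym family (every box, every root list `rs`) — `TorusCompositeInsertionKernelPackedSym` §1 with the block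
covariance `compVhS_translate` from an1's `symLinKerAt_add ∕ symVhKerAt_add`.
[folklore] BY NAME; no `def`, nothing cited, 0 sorry; NO chart; nothing of Bałaban's asserted — that this packed sym family IS the dressed chart's vertex through the
corrector of the (β1) tower is an2's (C1) TABLE word; the carriers' NAMES are the row's to give (the ∃-packaging defines nothing).

HONEST DEPENDENCY (page 1, mandatory): continuum YM on T⁴ ⇐ BetaPertH ∧ nine spine estimates (0/9 proved); BetaPertH ⇐ (D1) ∧ (D4) ∧ CAP+tail;
G-an2-4 gates asym, D1 and NE2/3/4.  HONEST FRAMING (cell contract, verbatim): «discharging `BetaPertH` makes Bałaban's UV stability UNCONDITIONAL —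
a real constructive-QFT result; it is NOT the continuum limit and NOT the Clay problem.»  ABSOLUTE RULE (cell charter, verbatim): «No internally-minted
statement may enter as a cited fact. Every hypothesis is either kernel-proved in this package or a verbatim quotation of a PUBLISHED theorem with page
reference. The manuscript(s) under audit are NOT citable for their own disputed steps — they are the thing under adjudication; programme-internal
(2001/route/tribunal) claims are never citable.»  0 estimates; 0∕4 row-D1 binders (hW, hR, D1Tel, D1Rep); NOT (T-ID), NOT (C1), NOT SDF, NOT D1,
NOT BetaPertH, NOT continuum, NOT Clay.  D1 formalisation swarm LEAF PROVER 02 (b2b-balaban-beta-d1-formalise-leaf-02 gen 32), 2026-08-24.  No existing file touched.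
v1.1 (leaf-02 g33, 2026-08-25): the four kernel-generic letters `mul_pairing_eq ∕ not_near_of_not_mem_window ∕ sum_window_eq ∕ sigma_eq` are READ BY NAME from the rooted F4 `TorusCompositeVertexJunction` (R-16) instead of re-typed (`dedup.landed` is α-invariant); the other declarations byte-identical to v1 942bc41d7bec558a.
-/

noncomputable section

open scoped BigOperators

namespace Summit.QuantumFields.BalabanUV.Beta.FP.TorusCompositeVertexJunctionSym

open Finset
open Literature.MathematicalPhysics.QuantumFieldTheory
open Literature.MathematicalPhysics.QuantumFieldTheory.Balaban1983to89
open Literature.MathematicalPhysics.QuantumFieldTheory.Balaban1983to89.Beta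
open B6Lemma24Torus (pbox)
open ExpKernelCalculus (MKer shiftK)
open AffineAveraging (Site Form1 box toSite)
open AveragingContoursRooted (ctr ctrOff)
open AveragingHessianKernels (Bond Near packVH)
open OneStepResolventKernel (Fib)
open Summit.QuantumFields.BalabanUV.Beta.BorderedHessian (stepScale stepScale_ne_zero)
open Summit.QuantumFields.BalabanUV.Beta.SymAveragingHessianCounts (symLinKerAt symVhKerAt symLinKerAt_eq_zero symLinKerAt_add symVhKerAt_add)
open Summit.QuantumFields.BalabanUV.Beta.FP.KernelPeriodisationFib (perZ)
open Summit.QuantumFields.BalabanUV.Beta.FP.KernelPeriodisationFibLoc (dper)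
open Summit.QuantumFields.BalabanUV.Beta.FP.TorusGaugeCovariancePairing (wrapPt)
open Summit.QuantumFields.BalabanUV.Beta.FP.TorusCompositeObjects (towerTorus)
open Summit.QuantumFields.BalabanUV.Beta.FP.TorusCompositeCovarianceOne (prod_stepScale_mul_card_ne_zero')
open Summit.QuantumFields.BalabanUV.Beta.FP.TorusCompositeCovarianceTwo (card_box_cast)
open Summit.QuantumFields.BalabanUV.Beta.FP.TorusCompositeCovarianceOneSym (compIns₁Sym)
open Summit.QuantumFields.BalabanUV.Beta.FP.TorusStepInsertionSym (symVhKerAt_ctr_eq_zero_left symVhKerAt_ctr_eq_zero_right)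
open Summit.QuantumFields.BalabanUV.Beta.CompositeVertexKernelRec (offs near_iff_exists_offs winF wid compLinKer compVHKer compVhS compLinKer_zero compLinKer_succ
  compVHKer_zero compVHKer_succ compLinKer_eq_zero compVHKer_eq_zero_left compVHKer_eq_zero_right compVhS_translate)
open Summit.QuantumFields.BalabanUV.Beta.FP.CompositeKernelFunctionalStep (tsum_sum_eq_finset_sum tsum_sum_finset_mul_eq pairing_of_kernel_succ)
open Summit.QuantumFields.BalabanUV.Beta.FP.TorusCompositeInsertionKernelPackedSym (sum_mul_perZ_dper_packVH_eq_compIns₁Sym_apply perZ_dper_packVH_eq_compIns₁Sym_apply_single)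
open Summit.QuantumFields.BalabanUV.Beta.FP.TorusCompositeVertexJunction (mul_pairing_eq not_near_of_not_mem_window sum_window_eq sigma_eq)

variable {d : ℕ} (Lc : ℕ) [NeZero Lc]

/-! ## §1 Plumbing (copies of the rooted file's §1, not yet importable) -/

/-! ## §2 The kernel functionals of the centred sym bricks: the four clauses AND the kernel identities -/

/-- [folklore] **`symKernelFunctionals_spec` — A PAIR `(𝓡, 𝓘)` SATISFYING THE FOUR CLAUSES OF `TorusCompositeInsertionPeriodicSym` (`hR0 ∕ hRsucc ∕ h0 ∕ hsucc`)
WHOSE VALUES AT EVERY DEPTH `n` AND EVERY `lev` ARE THE KERNEL FUNCTIONALS OF an2's COMPOSITE KERNELS OVER an1's CENTRED SYM BRICKS with unit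
`u_n = (∏_{i<n} stepScale d Lc (lev (i+1))) · #box^n`** (rows: `compLinKer_succ` + the bond window + an1's `symLinKerAt_eq_zero`; jet: R-13 `pairing_of_kernel_succ`
at `compVHKer_succ` with an1's sym brick windows, an2's composite windows, and the unit identities `u_{n+1} = θ_n · u′_n ² = stepScale d Lc (lev 1) · #box · u′_n`,
`#box = Lc^{d+1}`).  The bricks are CONSTANT in the storey, so no brick-list congruence is needed (contrast the rooted file). -/
theorem symKernelFunctionals_spec (hc : ctrOff (d + 1) Lc ∈ box (d + 1) Lc) :
    ∃ (𝓡 : (ℕ → ℕ) → ℕ → Form1 (d + 1) ℝ → Form1 (d + 1) ℝ) (𝓘 : (ℕ → ℕ) → ℕ → Form1 (d + 1) ℝ → Form1 (d + 1) ℝ → Form1 (d + 1) ℝ),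
      (∀ (lev : ℕ → ℕ) (B : Form1 (d + 1) ℝ), 𝓡 lev 0 B = B) ∧
      (∀ (lev : ℕ → ℕ) (n : ℕ) (B : Form1 (d + 1) ℝ) (κ : Fin (d + 1)) (x : Site (d + 1)),
        𝓡 lev (n + 1) B κ x = stepScale d Lc (lev 1) * ((Lc : ℝ) ^ (d + 1)
          * ∑' z : Site (d + 1), ∑ l : Fin (d + 1), symLinKerAt (ctr (d + 1) Lc) Lc κ x (l, z) * 𝓡 (fun k => lev (k + 1)) n B l z)) ∧
      (∀ (lev : ℕ → ℕ) (H B : Form1 (d + 1) ℝ), 𝓘 lev 0 H B = 0) ∧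
      (∀ (lev : ℕ → ℕ) (n : ℕ) (H B : Form1 (d + 1) ℝ) (κ : Fin (d + 1)) (x : Site (d + 1)),
        𝓘 lev (n + 1) H B κ x
          = (((Lc : ℝ) ^ (d + 1) * stepScale d Lc (lev 1)) * (∏ i ∈ Finset.range n, (stepScale d Lc (lev (i + 1 + 1)) * ((box (d + 1) Lc).card : ℝ)))⁻¹) *
              (∑' u : Site (d + 1), ∑ κ' : Fin (d + 1),
                (∑' z : Site (d + 1), ∑ l : Fin (d + 1), symVhKerAt (ctr (d + 1) Lc) Lc κ x (l, z) (κ', u) * 𝓡 (fun k => lev (k + 1)) n B l z) *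
                  𝓡 (fun k => lev (k + 1)) n H κ' u)
            + stepScale d Lc (lev 1) * ((Lc : ℝ) ^ (d + 1) *
                ∑' z : Site (d + 1), ∑ l : Fin (d + 1), symLinKerAt (ctr (d + 1) Lc) Lc κ x (l, z) * 𝓘 (fun k => lev (k + 1)) n H B l z)) ∧
      (∀ (lev : ℕ → ℕ) (n : ℕ) (B : Form1 (d + 1) ℝ) (l : Fin (d + 1)) (z : Site (d + 1)), 𝓡 lev n B l z
          = ((∏ i ∈ range n, stepScale d Lc (lev (i + 1))) * ((box (d + 1) Lc).card : ℝ) ^ n) *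
              ∑' w : Site (d + 1), ∑ m : Fin (d + 1), compLinKer (fun _ : ℕ => symLinKerAt (ctr (d + 1) Lc) Lc) Lc n (m, w) (l, z) * B m w) ∧
      (∀ (lev : ℕ → ℕ) (n : ℕ) (H B : Form1 (d + 1) ℝ) (κ : Fin (d + 1)) (x : Site (d + 1)), 𝓘 lev n H B κ x
          = ((∏ i ∈ range n, stepScale d Lc (lev (i + 1))) * ((box (d + 1) Lc).card : ℝ) ^ n) *
              ∑' u : Site (d + 1), ∑ κ' : Fin (d + 1), (∑' z : Site (d + 1), ∑ l : Fin (d + 1),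
                compVHKer (fun _ : ℕ => symLinKerAt (ctr (d + 1) Lc) Lc) (fun _ : ℕ => symVhKerAt (ctr (d + 1) Lc) Lc) Lc n κ x (l, z) (κ', u) * B l z) * H κ' u) := by
  classical
  have hLc : 1 ≤ Lc := Nat.one_le_iff_ne_zero.mpr (NeZero.ne Lc)
  -- the two functionals, DEFINED as the kernel functionals (with their defining equations as rewrite rules)
  obtain ⟨R, hR⟩ : ∃ R : (ℕ → ℕ) → ℕ → Form1 (d + 1) ℝ → Form1 (d + 1) ℝ, ∀ (lev : ℕ → ℕ) (n : ℕ) (B : Form1 (d + 1) ℝ) (l : Fin (d + 1)) (z : Site (d + 1)),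
      R lev n B l z = ((∏ i ∈ range n, stepScale d Lc (lev (i + 1))) * ((box (d + 1) Lc).card : ℝ) ^ n) *
        ∑' w : Site (d + 1), ∑ m : Fin (d + 1), compLinKer (fun _ : ℕ => symLinKerAt (ctr (d + 1) Lc) Lc) Lc n (m, w) (l, z) * B m w :=
    ⟨fun lev n B l z => _, fun _ _ _ _ _ => rfl⟩
  obtain ⟨I, hI⟩ : ∃ I : (ℕ → ℕ) → ℕ → Form1 (d + 1) ℝ → Form1 (d + 1) ℝ → Form1 (d + 1) ℝ,
      ∀ (lev : ℕ → ℕ) (n : ℕ) (H B : Form1 (d + 1) ℝ) (κ : Fin (d + 1)) (x : Site (d + 1)),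
      I lev n H B κ x = ((∏ i ∈ range n, stepScale d Lc (lev (i + 1))) * ((box (d + 1) Lc).card : ℝ) ^ n) *
        ∑' u : Site (d + 1), ∑ κ' : Fin (d + 1), (∑' z : Site (d + 1), ∑ l : Fin (d + 1),
          compVHKer (fun _ : ℕ => symLinKerAt (ctr (d + 1) Lc) Lc) (fun _ : ℕ => symVhKerAt (ctr (d + 1) Lc) Lc) Lc n κ x (l, z) (κ', u) * B l z) * H κ' u :=
    ⟨fun lev n H B κ x => _, fun _ _ _ _ _ _ => rfl⟩
  -- the bond window of a coarse site
  have hwin : ∀ x : Site (d + 1), ∃ P : Finset (Bond (d + 1)),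
      P = ((Finset.univ : Finset (Fin (d + 1))) ×ˢ offs Lc).image (fun p : Fin (d + 1) × Site (d + 1) => ((p.1, (Lc : ℤ) • x + p.2) : Bond (d + 1))) :=
    fun x => ⟨_, rfl⟩
  -- units
  have hu : ∀ (lev : ℕ → ℕ) (n : ℕ), (∏ i ∈ range (n + 1), stepScale d Lc (lev (i + 1))) * ((box (d + 1) Lc).card : ℝ) ^ (n + 1)
      = stepScale d Lc (lev 1) * (Lc : ℝ) ^ (d + 1) * ((∏ i ∈ range n, stepScale d Lc (lev (i + 1 + 1))) * ((box (d + 1) Lc).card : ℝ) ^ n) := fun lev n => by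
    rw [Finset.prod_range_succ', Nat.zero_add, pow_succ, ← card_box_cast Lc]; ring
  refine ⟨R, I, fun lev B => ?_, fun lev n B κ x => ?_, fun lev H B => ?_, fun lev n H B κ x => ?_, hR, hI⟩
  · -- `hR0`: depth 0 is the identity (`compLinKer … 0 = δ`)
    funext l z
    rw [hR, Finset.prod_range_zero, pow_zero, one_mul, one_mul]
    have hw : ∀ w : Site (d + 1), (∑ m : Fin (d + 1), compLinKer (fun _ : ℕ => symLinKerAt (ctr (d + 1) Lc) Lc) Lc 0 (m, w) (l, z) * B m w)
        = if w = z then B l z else 0 := fun w => by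
      by_cases h : w = z
      · subst h
        rw [if_pos rfl, Finset.sum_eq_single l (fun m _ hm => by rw [compLinKer_zero, if_neg (fun e => hm (Prod.mk.inj e).1.symm), zero_mul])
          (fun h => (h (Finset.mem_univ l)).elim), compLinKer_zero, if_pos rfl, one_mul]
      · rw [if_neg h]
        exact Finset.sum_eq_zero fun m _ => by rw [compLinKer_zero, if_neg (fun e => h (Prod.mk.inj e).2.symm), zero_mul]
    rw [tsum_congr hw, tsum_ite_eq]
  · -- `hRsucc`: an2's top peel of the linear kernel + the window + the units
    obtain ⟨P, hP⟩ := hwin x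
    have hk : ∀ (g : Bond (d + 1)) (m : Fin (d + 1)), ∀ w ∉ winF (Lc ^ n) (wid Lc n) g.2,
        compLinKer (fun _ : ℕ => symLinKerAt (ctr (d + 1) Lc) Lc) Lc n (m, w) g = 0 := fun g m w hw => compLinKer_eq_zero n (f := (m, w)) hw
    -- left: peel, then swap the finite window sum out of the lattice sum
    have hL : (∑' w : Site (d + 1), ∑ m : Fin (d + 1), compLinKer (fun _ : ℕ => symLinKerAt (ctr (d + 1) Lc) Lc) Lc (n + 1) (m, w) (κ, x) * B m w)
        = ∑ g ∈ P, symLinKerAt (ctr (d + 1) Lc) Lc κ x g *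
            ∑' w : Site (d + 1), ∑ m : Fin (d + 1), compLinKer (fun _ : ℕ => symLinKerAt (ctr (d + 1) Lc) Lc) Lc n (m, w) g * B m w := by
      rw [← tsum_sum_finset_mul_eq P (fun g => symLinKerAt (ctr (d + 1) Lc) Lc κ x g)
        (fun g m w => compLinKer (fun _ : ℕ => symLinKerAt (ctr (d + 1) Lc) Lc) Lc n (m, w) g) (fun g => winF (Lc ^ n) (wid Lc n) g.2) hk B]
      refine tsum_congr fun w => Finset.sum_congr rfl fun m _ => ?_
      rw [compLinKer_succ, ← sum_window_eq Lc x hP (fun g => symLinKerAt (ctr (d + 1) Lc) Lc κ x g *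
        compLinKer (fun _ : ℕ => symLinKerAt (ctr (d + 1) Lc) Lc) Lc n (m, w) g)]
    -- right: the brick vanishes off the window
    have hRt : (∑' z : Site (d + 1), ∑ l : Fin (d + 1), symLinKerAt (ctr (d + 1) Lc) Lc κ x (l, z) * R (fun k => lev (k + 1)) n B l z)
        = ∑ g ∈ P, symLinKerAt (ctr (d + 1) Lc) Lc κ x g * R (fun k => lev (k + 1)) n B g.1 g.2 :=
      tsum_sum_eq_finset_sum P (fun g => symLinKerAt (ctr (d + 1) Lc) Lc κ x g * R (fun k => lev (k + 1)) n B g.1 g.2)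
        fun g hg => mul_eq_zero_of_left (symLinKerAt_eq_zero hc (not_near_of_not_mem_window Lc x hP hg)) _
    rw [hR, hL, hRt, hu, Finset.mul_sum, Finset.mul_sum, Finset.mul_sum]
    refine Finset.sum_congr rfl fun g _ => ?_
    rw [hR]
    ring
  · -- `h0`: no second jet at depth 0
    funext κ x
    rw [hI]
    simp only [compVHKer_zero, zero_mul, Finset.sum_const_zero, tsum_zero, mul_zero]
    rfl
  · -- `hsucc`: R-13's abstract step at an2's top peel, read backwards
    obtain ⟨P, hP⟩ := hwin x
    have h0' : (∏ i ∈ range n, (stepScale d Lc (lev (i + 1 + 1)) * ((box (d + 1) Lc).card : ℝ))) ≠ 0 :=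
      prod_stepScale_mul_card_ne_zero' Lc ⟨ctrOff (d + 1) Lc, hc⟩ (fun i => lev (i + 1 + 1)) n
    -- the unit identities
    have hθ : ((Lc : ℝ) ^ (d + 1) * stepScale d Lc (lev 1)) * (∏ i ∈ range n, (stepScale d Lc (lev (i + 1 + 1)) * ((box (d + 1) Lc).card : ℝ)))⁻¹
          * ((∏ i ∈ range n, stepScale d Lc (lev (i + 1 + 1))) * ((box (d + 1) Lc).card : ℝ) ^ n)
          * ((∏ i ∈ range n, stepScale d Lc (lev (i + 1 + 1))) * ((box (d + 1) Lc).card : ℝ) ^ n)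
        = (∏ i ∈ range (n + 1), stepScale d Lc (lev (i + 1))) * ((box (d + 1) Lc).card : ℝ) ^ (n + 1) := by
      rw [hu, ← sigma_eq Lc lev n, mul_assoc ((Lc : ℝ) ^ (d + 1) * stepScale d Lc (lev 1)) _ _, inv_mul_cancel₀ h0', mul_one]
      ring
    rw [hI, mul_pairing_eq]
    refine pairing_of_kernel_succ P
      (((Lc : ℝ) ^ (d + 1) * stepScale d Lc (lev 1)) * (∏ i ∈ range n, (stepScale d Lc (lev (i + 1 + 1)) * ((box (d + 1) Lc).card : ℝ)))⁻¹)
      (stepScale d Lc (lev 1)) κ x (symVhKerAt (ctr (d + 1) Lc) Lc κ x)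
      (fun g g' hg => hg.elim (fun hg => symVhKerAt_ctr_eq_zero_left Lc hc (not_near_of_not_mem_window Lc x hP hg) g')
        fun hg' => symVhKerAt_ctr_eq_zero_right Lc hc g (not_near_of_not_mem_window Lc x hP hg'))
      (fun g => (Lc : ℝ) ^ (d + 1) * symLinKerAt (ctr (d + 1) Lc) Lc κ x g)
      (fun g hg => mul_eq_zero_of_right _ (symLinKerAt_eq_zero hc (not_near_of_not_mem_window Lc x hP hg)))
      (fun F => fun κ₀ y => (Lc : ℝ) ^ (d + 1) * ∑' z : Site (d + 1), ∑ l : Fin (d + 1), symLinKerAt (ctr (d + 1) Lc) Lc κ₀ y (l, z) * F l z) (fun F => ?_)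
      (fun g f => ((∏ i ∈ range n, stepScale d Lc (lev (i + 1 + 1))) * ((box (d + 1) Lc).card : ℝ) ^ n)
        * compLinKer (fun _ : ℕ => symLinKerAt (ctr (d + 1) Lc) Lc) Lc n f g)
      (fun g => winF (Lc ^ n) (wid Lc n) g.2) (fun g m w hw => mul_eq_zero_of_right _ (compLinKer_eq_zero n (f := (m, w)) hw))
      (R (fun k => lev (k + 1)) n) (fun B' g => ?_)
      (fun g f f' => ((∏ i ∈ range n, stepScale d Lc (lev (i + 1 + 1))) * ((box (d + 1) Lc).card : ℝ) ^ n)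
        * compVHKer (fun _ : ℕ => symLinKerAt (ctr (d + 1) Lc) Lc) (fun _ : ℕ => symVhKerAt (ctr (d + 1) Lc) Lc) Lc n g.1 g.2 f f')
      (fun g => winF (Lc ^ n) (wid Lc n) g.2) (fun g l f' z hz => mul_eq_zero_of_right _ (compVHKer_eq_zero_left n (f := (l, z)) f' hz))
      (fun g f κ' u hu => mul_eq_zero_of_right _ (compVHKer_eq_zero_right n f (f' := (κ', u)) hu))
      (I (fun k => lev (k + 1)) n) (fun H' B' g => ?_)
      (fun f f' => ((∏ i ∈ range (n + 1), stepScale d Lc (lev (i + 1))) * ((box (d + 1) Lc).card : ℝ) ^ (n + 1))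
        * compVHKer (fun _ : ℕ => symLinKerAt (ctr (d + 1) Lc) Lc) (fun _ : ℕ => symVhKerAt (ctr (d + 1) Lc) Lc) Lc (n + 1) κ x f f')
      (fun f f' => ?_) B H
    · -- `hAf`: the sym linear functional is the `a`-combination
      show (Lc : ℝ) ^ (d + 1) * (∑' z : Site (d + 1), ∑ l : Fin (d + 1), symLinKerAt (ctr (d + 1) Lc) Lc κ x (l, z) * F l z) = _
      rw [← tsum_mul_left]
      exact tsum_congr fun z => by rw [Finset.mul_sum]; exact Finset.sum_congr rfl fun l _ => (mul_assoc _ _ _).symm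
    · -- `hCf`: the lower rows functional is the kernel functional of the lower linear kernel
      obtain ⟨l, z⟩ := g
      rw [hR, ← tsum_mul_left]
      exact tsum_congr fun w => by rw [Finset.mul_sum]; exact Finset.sum_congr rfl fun m _ => (mul_assoc _ _ _).symm
    · -- `hℐ`: the lower jet functional is the kernel functional of the lower vertex kernel
      rw [hI]
      exact mul_pairing_eq _ (compVHKer (fun _ : ℕ => symLinKerAt (ctr (d + 1) Lc) Lc) (fun _ : ℕ => symVhKerAt (ctr (d + 1) Lc) Lc) Lc n g.1 g.2) B' H'
    · -- `h𝒦′`: an2's top peel + the units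
      rw [compVHKer_succ, mul_add]
      simp only [sum_window_eq Lc x hP, Finset.mul_sum]
      congr 1
      · refine Finset.sum_congr rfl fun κ₁ _ => Finset.sum_congr rfl fun e _ => Finset.sum_congr rfl fun κ₂ _ =>
          Finset.sum_congr rfl fun e' _ => ?_
        rw [← hθ]; ring
      · refine Finset.sum_congr rfl fun κ₁ _ => Finset.sum_congr rfl fun e _ => ?_
        rw [hu]; ring

/-! ## §3 F4-Sym: the order-1 Q-junction for the centred sym bricks, every box, every root list -/

section Junction

variable (hc : ctrOff (d + 1) Lc ∈ box (d + 1) Lc) (n : ℕ) (M : Fin (d + 1) → ℕ) [∀ μ, NeZero (M μ)] (lev : ℕ → ℕ) (rs : ℕ → (Fin (d + 1) → ℕ))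
include hc

/-- [folklore] **F4-Sym — THE (C1) Q-JUNCTION, ORDER 1, FOR THE ROW's PACKED COMPOSITE VERTEX FAMILY OVER an1's CENTRED SYM BRICKS**
(`TorusCompositeInsertionKernelPackedSym` §1 at `K := compVHKer ℓˢ 𝓋ˢ Lc n`, `cu := u_n`, with `symKernelFunctionals_spec`'s pair, an2's windows `compVHKer_eq_zero_left ∕ _right`
and block covariance `compVhS_translate` from an1's `symLinKerAt_add ∕ symVhKerAt_add`):
`Σ_b h b · perZ T (dper T (u_n • compVhS ℓˢ 𝓋ˢ Lc n b.2 b.1)) (Lc^n • x̄) z (inr κ) (inl β) = compIns₁Sym Lc M lev rs n h (x̄, κ) (z, β)`, `T = towerTorus Lc M n`, every box. -/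
theorem sum_mul_perZ_dper_compVhS_eq_compIns₁Sym_apply
    (h : ↥(pbox (towerTorus Lc M n)) × Fin (d + 1) → ℝ) (x : ↥(pbox M)) (κ : Fin (d + 1)) (z : ↥(pbox (towerTorus Lc M n))) (β : Fin (d + 1)) :
    ∑ b : ↥(pbox (towerTorus Lc M n)) × Fin (d + 1), h b *
        perZ (towerTorus Lc M n) (dper (towerTorus Lc M n)
          ((((∏ i ∈ range n, stepScale d Lc (lev (i + 1))) * ((box (d + 1) Lc).card : ℝ) ^ n)) •
            compVhS (fun _ : ℕ => symLinKerAt (ctr (d + 1) Lc) Lc) (fun _ : ℕ => symVhKerAt (ctr (d + 1) Lc) Lc) Lc n b.2 (b.1 : Site (d + 1))))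
          ((((Lc ^ n : ℕ) : ℤ)) • (x : Site (d + 1))) (z : Site (d + 1)) (Sum.inr κ) (Sum.inl β)
      = compIns₁Sym Lc M lev rs n h (x, κ) (z, β) := by
  obtain ⟨𝓡, 𝓘, hR0, hRsucc, h0, hsucc, -, h𝓘⟩ := symKernelFunctionals_spec (d := d) Lc hc
  exact sum_mul_perZ_dper_packVH_eq_compIns₁Sym_apply Lc hc 𝓡 hR0 hRsucc 𝓘 h0 hsucc n M lev rs
    (compVHKer (fun _ : ℕ => symLinKerAt (ctr (d + 1) Lc) Lc) (fun _ : ℕ => symVhKerAt (ctr (d + 1) Lc) Lc) Lc n)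
    ((∏ i ∈ range n, stepScale d Lc (lev (i + 1))) * ((box (d + 1) Lc).card : ℝ) ^ n) (winF (Lc ^ n) (wid Lc n))
    (fun μ y α κ' u w hw => compVHKer_eq_zero_left n (f := (α, w)) (κ', u) hw)
    (fun μ y α w κ' u hu => compVHKer_eq_zero_right n (α, w) (f' := (κ', u)) hu)
    (fun κ' u t => compVhS_translate (Nat.one_le_iff_ne_zero.mpr (NeZero.ne Lc))
      (fun _ μ y t f => symLinKerAt_add (ctr (d + 1) Lc) Lc μ y t f) (fun _ μ y t f f' => symVhKerAt_add (ctr (d + 1) Lc) Lc μ y t f f') n κ' u t)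
    (fun H B κ x => h𝓘 lev n H B κ x) h x κ z β

/-- [folklore] **F4-Sym, ONE-BOND FORM = the `-Sym` door's `hQF₁ ∕ hQF₁′` AT THE ROW's SYM FAMILY**: for every finest bond `(κ′, u)`,
`perZ T (dper T (u_n • compVhS ℓˢ 𝓋ˢ Lc n κ′ u)) (Lc^n • x̄) z (inr κ) (inl β) = compIns₁Sym Lc M lev rs n (𝟙_{(wrapPt T u, κ′)}) (x̄, κ) (z, β)`. -/
theorem perZ_dper_compVhS_eq_compIns₁Sym_apply_single
    (κ' : Fin (d + 1)) (u : Site (d + 1)) (x : ↥(pbox M)) (κ : Fin (d + 1)) (z : ↥(pbox (towerTorus Lc M n))) (β : Fin (d + 1)) :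
    perZ (towerTorus Lc M n) (dper (towerTorus Lc M n)
        ((((∏ i ∈ range n, stepScale d Lc (lev (i + 1))) * ((box (d + 1) Lc).card : ℝ) ^ n)) •
          compVhS (fun _ : ℕ => symLinKerAt (ctr (d + 1) Lc) Lc) (fun _ : ℕ => symVhKerAt (ctr (d + 1) Lc) Lc) Lc n κ' u))
        ((((Lc ^ n : ℕ) : ℤ)) • (x : Site (d + 1))) (z : Site (d + 1)) (Sum.inr κ) (Sum.inl β)
      = compIns₁Sym Lc M lev rs n (fun b => if b = (wrapPt (towerTorus Lc M n) u, κ') then 1 else 0) (x, κ) (z, β) := by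
  obtain ⟨𝓡, 𝓘, hR0, hRsucc, h0, hsucc, -, h𝓘⟩ := symKernelFunctionals_spec (d := d) Lc hc
  exact perZ_dper_packVH_eq_compIns₁Sym_apply_single Lc hc 𝓡 hR0 hRsucc 𝓘 h0 hsucc n M lev rs
    (compVHKer (fun _ : ℕ => symLinKerAt (ctr (d + 1) Lc) Lc) (fun _ : ℕ => symVhKerAt (ctr (d + 1) Lc) Lc) Lc n)
    ((∏ i ∈ range n, stepScale d Lc (lev (i + 1))) * ((box (d + 1) Lc).card : ℝ) ^ n) (winF (Lc ^ n) (wid Lc n))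
    (fun μ y α κ' u w hw => compVHKer_eq_zero_left n (f := (α, w)) (κ', u) hw)
    (fun μ y α w κ' u hu => compVHKer_eq_zero_right n (α, w) (f' := (κ', u)) hu)
    (fun κ' u t => compVhS_translate (Nat.one_le_iff_ne_zero.mpr (NeZero.ne Lc))
      (fun _ μ y t f => symLinKerAt_add (ctr (d + 1) Lc) Lc μ y t f) (fun _ μ y t f f' => symVhKerAt_add (ctr (d + 1) Lc) Lc μ y t f f') n κ' u t)
    (fun H B κ x => h𝓘 lev n H B κ x) κ' u x κ z β

end Junction

end Summit.QuantumFields.BalabanUV.Beta.FP.TorusCompositeVertexJunctionSym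

end
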